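/-
Origin: expansion seat `planner-pub-hodgecm-mc-theta-3-g28-0`, handover #S19 2026-08-21T03:29Z md5 fcd01948ca1c (280 l.; NEW; imports HodgeCM.Model.LiuIndexTwistType (#S18) + HodgeCM.Model.AdelicLinePair (#1255 landed); NEW THEOREM NAMES for audit: HodgeCM.Model.LiuIndex.twistInf_bigCharOfV · HodgeCM.Model.LiuIndex.centralTypeOfTwist_bigCharOfV_of_CC · HodgeCM.Model.LiuIndex.I.exists_line_eq_twistBy_bigCharOfV_of_CC) (`HOME/mc/pub-hodgecm-mc-theta-3-g28/stage71/HodgeCM/Model/LiuIndexTwistTypeOfV.lean`, md5 fcd01948ca1c, 280 lines);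
landed by the gen-30 packager (p-g30) in gate run 71 as `HodgeCM/Model/LiuIndexTwistTypeOfV.lean` (verbatim).
-/
/-
Origin: THETA seat `planner-pub-hodgecm-mc-theta-3-g28-0` (unit pub-hodgecm-mc-theta-3-g28, gen 28 of mc-theta-3: theta supply ∕ second-lift ∕ see-saw lane)
2026-08-21.  #S19 (NEW; child of #S18 `Model/LiuIndexTwistType` (RUN-70 kit row 3) and of sinst-1 #1255 `Model/AdelicLinePair` (LANDED RUN 69)).
Target in PKG: `HodgeCM/Model/LiuIndexTwistTypeOfV.lean` (additive KERNEL leaf beside E; nothing imports it; outside E's import closure).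
KERNEL ONLY: for a twist by `ĉ := bigCharOfV c_V` (the shape of every slot's twist of record, carch-1-g37 STATUS l.15034 (2)), the archimedean
restriction `twistInf` IS `c_V` read on the archimedean `V`-centre, hence continuous when `c_V` is, and the twisted central type is
`charArchType (c_V ∘ centre_∞) + centralTypeOf`.  0 records, nothing cited as a fact, 0 closed Props.  Nothing here is a claim of the manuscripts
under adjudication.
-/
import Summits.HodgeConjecture.HodgeCM.Model.LiuIndexTwistType
import Summits.HodgeConjecture.HodgeCM.Model.AdelicLinePair

set_option autoImplicit false

/-!
# (J3 ∕ K0) THE TWISTED CENTRAL TYPE FOR `ĉ = bigCharOfV c_V` — `LiuIndex.centerCharInf V c_V`, `LiuIndex.centralTypeOfTwist_bigCharOfV`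

Every slot's dictionary record is the record of record twisted by `ĉ_k := bigCharOfV s_k` for a character `s_k` of `U(J_V)(𝔸)` (sinst-1 #1256
`bigCharZero = bigCharOfV … (adelicCharZero …)`; carch-1-g37 l.15034 (2): `s₁ = ν` at the pin of record, `s₂`, `s₃` likewise).  For such `ĉ`:

* §1 `centerCharInf V c_V : U(1)(L⁺ ⊗ ℝ) →* ℂ`, `t ↦ c_V(u_t · 1_V)` — the `V`-character read on the archimedean centre (carch's `s_k (CMCenter (frameD V) u_t)`),
  continuous when `c_V` is, in sinst-1's ℂ-valued currency `Continuous fun v => ((c_V v : ℂˣ) : ℂ)` (`continuous_centerCharInf`);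
* §2 `twistInf_bigCharOfV : twistInf V a (bigCharOfV … c_V) = centerCharInf V c_V` (#1255 `bigCharOfV_adelicInl`: `ĉ(g ⊗ 1) = c_V g`, and
  `pairMap (x, 1) = x ⊗ 1`), hence `continuous_twistInf_bigCharOfV`;
* §3 `centralTypeOfTwist_bigCharOfV : centralTypeOfTwist V a hGR (bigCharOfV … c_V) _ = charArchType L (centerCharInf V c_V) _ + centralTypeOf V a hGR`
  and the pointed corollary `I.exists_line_eq_twistBy_bigCharOfV_of_eq` with the recipe value in that split form;
* §4 CLOSED FORM under carch's centre identity (CC) `c_V(u_t·1_V) · lineC … hGR t = 1` (carch-1-g37, discharged for the honest harmonic datum):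
  `centralTypeOfTwist_bigCharOfV_of_CC : centralTypeOfTwist … = −𝟙_{w(ι₁)}` — CONSTANT, the same for every slot and every chosen splitting — with
  `hasCentralTypeAt_twistBy_bigCharOfV_iff_of_CC` (`… ↔ m = −𝟙_{w(ι₁)}`) and `I.exists_line_eq_twistBy_bigCharOfV_of_CC` (recipe value `μ ⟦a⟧ = −𝟙_{w(ι₁)}`).

So at a twisted slot the junction input reads: `μ₀ ⟦a_k⟧ = charArchType (s_k ∘ centre_∞) + centralTypeOf V a_k hGR_k` — the type of the
`V`-character on the archimedean centre plus the type of (F1)'s vacuum character of the record of record.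
-/

noncomputable section

open NumberField NumberField.InfinitePlace NumberField.mixedEmbedding
open scoped Matrix SchwartzMap Classical
open Literature.NumberTheory.Automorphic Literature.NumberTheory.Automorphic.UnitaryGroup Literature.NumberTheory.Weil1964
open Literature.RepresentationTheory.KonnoKonno2007 Literature.RepresentationTheory.KonnoKonno2007.RealDualPair
open Literature.NumberTheory.GelbartRogawski1991 Literature.NumberTheory.GelbartRogawski1991.UnitaryDualPair
open Literature.Analysis.SegalBargmann
open HodgeCM.Model.SupplyInstance (testFun archEmb)

namespace HodgeCM.Model

open HodgeCM.Model.ArchSideTerm (e₁ lineCenterChar infUnitToOne continuous_infUnitToOne)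

namespace LiuIndex

variable {L : CMField} {ι₁ : (L : Type) →+* ℂ} (V : HermSpace3 L ι₁)

/-! ## §1 A `V`-character read on the archimedean centre -/

/-- **`t ↦ c_V(u_t · 1_V)`**: a character of `U(J_V)(𝔸)` read on the archimedean centre path (`u_t = infUnitToOne L t`). [folklore] -/
def centerCharInf
    (cV : ↥(UnitaryGroup.adelic (↥(maximalRealSubfield (L : Type))) (L : Type) (IsCMField.complexConj (L : Type)) 3
        (Matrix.diagonal (frameD V))) →* ℂˣ) :
    ↥(Literature.NumberTheory.Automorphic.relNormOneInfUnits (↥(maximalRealSubfield (L : Type))) (L : Type)) →* ℂ :=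
  (Units.coeHom ℂ).comp (cV.comp ((CMCenter (L : Type) (frameD V)).comp (infUnitToOne (L : Type))))

/-- formula (definitional). [folklore] -/
theorem centerCharInf_apply
    (cV : ↥(UnitaryGroup.adelic (↥(maximalRealSubfield (L : Type))) (L : Type) (IsCMField.complexConj (L : Type)) 3
        (Matrix.diagonal (frameD V))) →* ℂˣ)
    (t : ↥(Literature.NumberTheory.Automorphic.relNormOneInfUnits (↥(maximalRealSubfield (L : Type))) (L : Type))) :
    centerCharInf V cV t = ((cV (CMCenter (L : Type) (frameD V) (infUnitToOne (L : Type) t)) : ℂˣ) : ℂ) :=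
  rfl

/-- `centerCharInf V c_V` is continuous when `c_V` is. [folklore] -/
theorem continuous_centerCharInf
    (cV : ↥(UnitaryGroup.adelic (↥(maximalRealSubfield (L : Type))) (L : Type) (IsCMField.complexConj (L : Type)) 3
        (Matrix.diagonal (frameD V))) →* ℂˣ)
    (hcV : Continuous fun v => ((cV v : ℂˣ) : ℂ)) : Continuous (centerCharInf V cV) :=
  hcV.comp ((continuous_adelicCenter _ _ _ _ _).comp (continuous_infUnitToOne (L : Type)))

/-! ## §2 `twistInf` of `bigCharOfV c_V` is `centerCharInf c_V` -/

/-- **`twistInf V a (bigCharOfV … c_V) = centerCharInf V c_V`**: along the centre path `(u_t · 1_V, 1) ↦ (u_t · 1_V) ⊗ 1`, and `ĉ(g ⊗ 1) = c_V(g)`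
(#1255 `bigCharOfV_adelicInl`). [folklore] -/
theorem twistInf_bigCharOfV (a : RealScalar L) (hJW : (Matrix.diagonal (RealScalar.vec a)) default default ≠ 0)
    (cV : ↥(UnitaryGroup.adelic (↥(maximalRealSubfield (L : Type))) (L : Type) (IsCMField.complexConj (L : Type)) 3
        (Matrix.diagonal (frameD V))) →* ℂˣ) :
    twistInf V a
        (HodgeCM.LinePair.bigCharOfV (↥(maximalRealSubfield (L : Type))) (L : Type) (IsCMField.complexConj (L : Type)) 3
          (Matrix.diagonal (frameD V)) (Matrix.diagonal (RealScalar.vec a)) hJW cV) =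
      centerCharInf V cV := by
  ext t
  rw [twistInf_apply, pairMap_apply, map_one, mul_one, HodgeCM.LinePair.bigCharOfV_adelicInl]
  rfl

/-- hence `twistInf V a (bigCharOfV … c_V)` is continuous when `c_V` is. [folklore] -/
theorem continuous_twistInf_bigCharOfV (a : RealScalar L) (hJW : (Matrix.diagonal (RealScalar.vec a)) default default ≠ 0)
    (cV : ↥(UnitaryGroup.adelic (↥(maximalRealSubfield (L : Type))) (L : Type) (IsCMField.complexConj (L : Type)) 3
        (Matrix.diagonal (frameD V))) →* ℂˣ)
    (hcV : Continuous fun v => ((cV v : ℂˣ) : ℂ)) :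
    Continuous
      (twistInf V a
        (HodgeCM.LinePair.bigCharOfV (↥(maximalRealSubfield (L : Type))) (L : Type) (IsCMField.complexConj (L : Type)) 3
          (Matrix.diagonal (frameD V)) (Matrix.diagonal (RealScalar.vec a)) hJW cV)) := by
  rw [twistInf_bigCharOfV]
  exact continuous_centerCharInf V cV hcV

/-! ## §3 The twisted central type for `ĉ = bigCharOfV c_V` -/

/-- the archimedean type of `twistInf (bigCharOfV c_V)` is that of `centerCharInf c_V`. [folklore] -/
theorem charArchType_twistInf_bigCharOfV (a : RealScalar L) (hJW : (Matrix.diagonal (RealScalar.vec a)) default default ≠ 0)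
    (cV : ↥(UnitaryGroup.adelic (↥(maximalRealSubfield (L : Type))) (L : Type) (IsCMField.complexConj (L : Type)) 3
        (Matrix.diagonal (frameD V))) →* ℂˣ)
    (hcV : Continuous fun v => ((cV v : ℂˣ) : ℂ))
    (h : Continuous
      (twistInf V a
        (HodgeCM.LinePair.bigCharOfV (↥(maximalRealSubfield (L : Type))) (L : Type) (IsCMField.complexConj (L : Type)) 3
          (Matrix.diagonal (frameD V)) (Matrix.diagonal (RealScalar.vec a)) hJW cV))) :
    Literature.NumberTheory.Automorphic.charArchType (L : Type)
        (twistInf V a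
          (HodgeCM.LinePair.bigCharOfV (↥(maximalRealSubfield (L : Type))) (L : Type) (IsCMField.complexConj (L : Type)) 3
            (Matrix.diagonal (frameD V)) (Matrix.diagonal (RealScalar.vec a)) hJW cV)) h =
      Literature.NumberTheory.Automorphic.charArchType (L : Type) (centerCharInf V cV) (continuous_centerCharInf V cV hcV) := by
  rw [Literature.NumberTheory.Automorphic.charArchType_eq_iff, Literature.NumberTheory.Automorphic.archWeight_charArchType,
    twistInf_bigCharOfV]

/-- **the twisted central type for `ĉ = bigCharOfV c_V`**: `centralTypeOfTwist = charArchType (c_V ∘ centre_∞) + centralTypeOf`. [folklore] -/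
theorem centralTypeOfTwist_bigCharOfV (a : RealScalar L)
    (hGR : (cmSplittingDatum (L : Type) e₁ (frameD V) (frameD_real V) (frameD_ne V) (RealScalar.vec a) (RealScalar.vec_real a)
      (RealScalar.vec_ne a)).CompatibleSplitting)
    (hJW : (Matrix.diagonal (RealScalar.vec a)) default default ≠ 0)
    (cV : ↥(UnitaryGroup.adelic (↥(maximalRealSubfield (L : Type))) (L : Type) (IsCMField.complexConj (L : Type)) 3
        (Matrix.diagonal (frameD V))) →* ℂˣ)
    (hcV : Continuous fun v => ((cV v : ℂˣ) : ℂ))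
    (h : Continuous
      (twistInf V a
        (HodgeCM.LinePair.bigCharOfV (↥(maximalRealSubfield (L : Type))) (L : Type) (IsCMField.complexConj (L : Type)) 3
          (Matrix.diagonal (frameD V)) (Matrix.diagonal (RealScalar.vec a)) hJW cV))) :
    centralTypeOfTwist V a hGR
        (HodgeCM.LinePair.bigCharOfV (↥(maximalRealSubfield (L : Type))) (L : Type) (IsCMField.complexConj (L : Type)) 3
          (Matrix.diagonal (frameD V)) (Matrix.diagonal (RealScalar.vec a)) hJW cV) h =
      Literature.NumberTheory.Automorphic.charArchType (L : Type) (centerCharInf V cV) (continuous_centerCharInf V cV hcV) +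
        centralTypeOf V a hGR := by
  rw [centralTypeOfTwist_eq_add, charArchType_twistInf_bigCharOfV V a hJW cV hcV]

variable (ρ : GramClass L → RealScalar L)

variable {ρ} in
/-- **the pointed corollary at a `bigCharOfV`-twisted slot**: from `ρ q = a` and
`μ ⟦a⟧ = charArchType (c_V ∘ centre_∞) + centralTypeOf V a hGR`, an index `j : I V ρ μ` over `q` with
`line V ρ μ j = (ofCMOf … hGR).twistBy (bigCharOfV … c_V) hĉ` ON THE NOSE. [folklore] -/
theorem I.exists_line_eq_twistBy_bigCharOfV_of_eq (μ : GramClass L → (InfinitePlace (L : Type) → ℤ)) {q : GramClass L}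
    {a : RealScalar L} (hq : ρ q = a)
    (hGR : (cmSplittingDatum (L : Type) e₁ (frameD V) (frameD_real V) (frameD_ne V) (RealScalar.vec a) (RealScalar.vec_real a)
      (RealScalar.vec_ne a)).CompatibleSplitting)
    (hJW : (Matrix.diagonal (RealScalar.vec a)) default default ≠ 0)
    (cV : ↥(UnitaryGroup.adelic (↥(maximalRealSubfield (L : Type))) (L : Type) (IsCMField.complexConj (L : Type)) 3
        (Matrix.diagonal (frameD V))) →* ℂˣ)
    (hcV : Continuous fun v => ((cV v : ℂˣ) : ℂ))
    (hĉ : (SplitLineE.ofCMOf V e₁ (RealScalar.vec a) (RealScalar.vec_real a) (RealScalar.vec_ne a) hGR).IsRatTrivial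
      (HodgeCM.LinePair.bigCharOfV (↥(maximalRealSubfield (L : Type))) (L : Type) (IsCMField.complexConj (L : Type)) 3
        (Matrix.diagonal (frameD V)) (Matrix.diagonal (RealScalar.vec a)) hJW cV))
    (hμ : μ (GramClass.mk a) =
      Literature.NumberTheory.Automorphic.charArchType (L : Type) (centerCharInf V cV) (continuous_centerCharInf V cV hcV) +
        centralTypeOf V a hGR) :
    ∃ j : I V ρ μ, j.1 = q ∧
      line V ρ μ j =
        (SplitLineE.ofCMOf V e₁ (RealScalar.vec a) (RealScalar.vec_real a) (RealScalar.vec_ne a) hGR).twistBy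
          (HodgeCM.LinePair.bigCharOfV (↥(maximalRealSubfield (L : Type))) (L : Type) (IsCMField.complexConj (L : Type)) 3
            (Matrix.diagonal (frameD V)) (Matrix.diagonal (RealScalar.vec a)) hJW cV) hĉ :=
  I.exists_line_eq_twistBy_ofCMOf_of_eq V μ hq hGR _ hĉ (continuous_twistInf_bigCharOfV V a hJW cV hcV)
    (hμ.trans (centralTypeOfTwist_bigCharOfV V a hGR hJW cV hcV _).symm)

/-! ## §4 Closed form under carch's centre identity (CC): the twisted type is `−𝟙_{w(ι₁)}`, the same for every slot

carch-1-g37 (STATUS 2026-08-21T03:21:40Z) discharges, for the honest harmonic datum, the centre identity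
**(CC)** `c_V(u_t · 1_V) · lineC(t) = 1` with (F1)'s centre eigenvalue `lineC … hGR t = lineCenterChar … hGR t · ι_{w(ι₁)}(t)` (tree
`ArchSideTerm.lineC_def`).  Under (CC) the twisted central type is the CONSTANT vector `−𝟙_{w(ι₁)}` — independent of the slot, of the scalar
`a` and of the chosen splitting `hGR.choose` — so ONE recipe value serves every slot: `μ₀ ⟦a_k⟧ = −𝟙_{w(ι₁)}`. -/

/-- weight of a single place: `archWeight L (𝟙_w · n) t = ι_w(t) ^ n`. [folklore] -/
theorem archWeight_single_zpow (w : InfinitePlace (L : Type)) (n : ℤ)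
    (t : ↥(Literature.NumberTheory.Automorphic.relNormOneInfUnits (↥(maximalRealSubfield (L : Type))) (L : Type))) :
    Literature.NumberTheory.Automorphic.archWeight (L : Type) (Pi.single w n) t =
      ((Literature.NumberTheory.Automorphic.archPlaceChar (L : Type) w t : Circle) : ℂ) ^ n := by
  rw [Literature.NumberTheory.Automorphic.archWeight_eq_prod, Finset.prod_eq_single w (fun w' _ hw' => by rw [Pi.single_eq_of_ne hw', zpow_zero])
    (fun h => absurd (Finset.mem_univ w) h), Pi.single_eq_same]

/-- the archimedean type of the place character `ι_w` is the indicator `𝟙_w`. [folklore] -/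
theorem charArchType_archPlaceChar (w : InfinitePlace (L : Type)) :
    Literature.NumberTheory.Automorphic.charArchType (L : Type) (Circle.coeHom.comp (Literature.NumberTheory.Automorphic.archPlaceChar (L : Type) w))
        (continuous_subtype_val.comp (Literature.NumberTheory.Automorphic.continuous_archPlaceChar (L : Type) w)) = Pi.single w 1 := by
  rw [Literature.NumberTheory.Automorphic.charArchType_eq_iff]
  ext t
  rw [archWeight_single_zpow, zpow_one]
  rfl

/-- **THE TWISTED CENTRAL TYPE UNDER (CC) is `−𝟙_{w(ι₁)}`**: if `c_V(u_t · 1_V) · lineC … hGR t = 1` for all `t` (carch's (CC_k)), then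
`centralTypeOfTwist V a hGR (bigCharOfV … c_V) _ = −𝟙_{w(ι₁)}` (`w(ι₁) := (cmPlaceOver L (cmPlace L ι₁)).1`). [folklore] -/
theorem centralTypeOfTwist_bigCharOfV_of_CC (a : RealScalar L)
    (hGR : (cmSplittingDatum (L : Type) e₁ (frameD V) (frameD_real V) (frameD_ne V) (RealScalar.vec a) (RealScalar.vec_real a)
      (RealScalar.vec_ne a)).CompatibleSplitting)
    (hJW : (Matrix.diagonal (RealScalar.vec a)) default default ≠ 0)
    (cV : ↥(UnitaryGroup.adelic (↥(maximalRealSubfield (L : Type))) (L : Type) (IsCMField.complexConj (L : Type)) 3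
        (Matrix.diagonal (frameD V))) →* ℂˣ)
    (hcV : Continuous fun v => ((cV v : ℂˣ) : ℂ))
    (hCC : ∀ t, ((cV (CMCenter (L : Type) (frameD V) (infUnitToOne (L : Type) t)) : ℂˣ) : ℂ) *
      HodgeCM.Model.ArchSideTerm.lineC V a.1 a.2.1 a.2.2 hGR t = 1)
    (h : Continuous
      (twistInf V a
        (HodgeCM.LinePair.bigCharOfV (↥(maximalRealSubfield (L : Type))) (L : Type) (IsCMField.complexConj (L : Type)) 3
          (Matrix.diagonal (frameD V)) (Matrix.diagonal (RealScalar.vec a)) hJW cV))) :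
    centralTypeOfTwist V a hGR
        (HodgeCM.LinePair.bigCharOfV (↥(maximalRealSubfield (L : Type))) (L : Type) (IsCMField.complexConj (L : Type)) 3
          (Matrix.diagonal (frameD V)) (Matrix.diagonal (RealScalar.vec a)) hJW cV) h =
      -(Pi.single (cmPlaceOver (L : Type) (HypCensus.cmPlace (L : Type) ι₁)).1 1) := by
  rw [centralTypeOfTwist_bigCharOfV V a hGR hJW cV hcV, ← eq_sub_iff_add_eq, Literature.NumberTheory.Automorphic.charArchType_eq_iff]
  ext t
  have hl : Literature.NumberTheory.Automorphic.archWeight (L : Type) (centralTypeOf V a hGR) t = ((lineCenterChar V a.1 a.2.1 a.2.2 hGR t : Circle) : ℂ) := by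
    rw [centralTypeOf_eq_charArchType_kappaOf, Literature.NumberTheory.Automorphic.archWeight_charArchType]
    rfl
  have hp : Literature.NumberTheory.Automorphic.archWeight (L : Type) (Pi.single (cmPlaceOver (L : Type) (HypCensus.cmPlace (L : Type) ι₁)).1 1) t =
      ((NumberField.archPlaceChar (L : Type) (cmPlaceOver (L : Type) (HypCensus.cmPlace (L : Type) ι₁)).1 t : Circle) : ℂ) := by
    rw [archWeight_single_zpow, zpow_one]
    rfl
  have hc := hCC t
  rw [HodgeCM.Model.ArchSideTerm.lineC_def] at hc
  rw [sub_eq_add_neg, Literature.NumberTheory.Automorphic.archWeight_add, Literature.NumberTheory.Automorphic.archWeight_neg, Literature.NumberTheory.Automorphic.archWeight_neg, hp, hl,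
    centerCharInf_apply]
  rw [← mul_inv, mul_comm ((NumberField.archPlaceChar _ _ _ : Circle) : ℂ)]
  exact (eq_inv_of_mul_eq_one_left hc).symm

/-- hence, under (CC), **the type check at a `bigCharOfV c_V`-twisted slot reads `m = −𝟙_{w(ι₁)}`** — one recipe value for every slot. [folklore] -/
theorem hasCentralTypeAt_twistBy_bigCharOfV_iff_of_CC (a : RealScalar L)
    (hGR : (cmSplittingDatum (L : Type) e₁ (frameD V) (frameD_real V) (frameD_ne V) (RealScalar.vec a) (RealScalar.vec_real a)
      (RealScalar.vec_ne a)).CompatibleSplitting)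
    (hJW : (Matrix.diagonal (RealScalar.vec a)) default default ≠ 0)
    (cV : ↥(UnitaryGroup.adelic (↥(maximalRealSubfield (L : Type))) (L : Type) (IsCMField.complexConj (L : Type)) 3
        (Matrix.diagonal (frameD V))) →* ℂˣ)
    (hcV : Continuous fun v => ((cV v : ℂˣ) : ℂ))
    (hCC : ∀ t, ((cV (CMCenter (L : Type) (frameD V) (infUnitToOne (L : Type) t)) : ℂˣ) : ℂ) *
      HodgeCM.Model.ArchSideTerm.lineC V a.1 a.2.1 a.2.2 hGR t = 1)
    (hĉ : (SplitLineE.ofCMOf V e₁ (RealScalar.vec a) (RealScalar.vec_real a) (RealScalar.vec_ne a) hGR).IsRatTrivial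
      (HodgeCM.LinePair.bigCharOfV (↥(maximalRealSubfield (L : Type))) (L : Type) (IsCMField.complexConj (L : Type)) 3
        (Matrix.diagonal (frameD V)) (Matrix.diagonal (RealScalar.vec a)) hJW cV))
    (m : InfinitePlace (L : Type) → ℤ) :
    HasCentralTypeAt V a
        ((SplitLineE.ofCMOf V e₁ (RealScalar.vec a) (RealScalar.vec_real a) (RealScalar.vec_ne a) hGR).twistBy
          (HodgeCM.LinePair.bigCharOfV (↥(maximalRealSubfield (L : Type))) (L : Type) (IsCMField.complexConj (L : Type)) 3
            (Matrix.diagonal (frameD V)) (Matrix.diagonal (RealScalar.vec a)) hJW cV) hĉ).s m ↔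
      m = -(Pi.single (cmPlaceOver (L : Type) (HypCensus.cmPlace (L : Type) ι₁)).1 1) := by
  rw [hasCentralTypeAt_twistBy_ofCMOf_iff_eq V a hGR _ hĉ (continuous_twistInf_bigCharOfV V a hJW cV hcV),
    centralTypeOfTwist_bigCharOfV_of_CC V a hGR hJW cV hcV hCC]

variable {ρ} in
/-- **the pointed corollary under (CC)**: from `ρ q = a`, (CC) and the recipe value `μ ⟦a⟧ = −𝟙_{w(ι₁)}`, an index over `q` whose line IS the
`bigCharOfV c_V`-twisted record of record. [folklore] -/
theorem I.exists_line_eq_twistBy_bigCharOfV_of_CC (μ : GramClass L → (InfinitePlace (L : Type) → ℤ)) {q : GramClass L}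
    {a : RealScalar L} (hq : ρ q = a)
    (hGR : (cmSplittingDatum (L : Type) e₁ (frameD V) (frameD_real V) (frameD_ne V) (RealScalar.vec a) (RealScalar.vec_real a)
      (RealScalar.vec_ne a)).CompatibleSplitting)
    (hJW : (Matrix.diagonal (RealScalar.vec a)) default default ≠ 0)
    (cV : ↥(UnitaryGroup.adelic (↥(maximalRealSubfield (L : Type))) (L : Type) (IsCMField.complexConj (L : Type)) 3
        (Matrix.diagonal (frameD V))) →* ℂˣ)
    (hcV : Continuous fun v => ((cV v : ℂˣ) : ℂ))
    (hCC : ∀ t, ((cV (CMCenter (L : Type) (frameD V) (infUnitToOne (L : Type) t)) : ℂˣ) : ℂ) *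
      HodgeCM.Model.ArchSideTerm.lineC V a.1 a.2.1 a.2.2 hGR t = 1)
    (hĉ : (SplitLineE.ofCMOf V e₁ (RealScalar.vec a) (RealScalar.vec_real a) (RealScalar.vec_ne a) hGR).IsRatTrivial
      (HodgeCM.LinePair.bigCharOfV (↥(maximalRealSubfield (L : Type))) (L : Type) (IsCMField.complexConj (L : Type)) 3
        (Matrix.diagonal (frameD V)) (Matrix.diagonal (RealScalar.vec a)) hJW cV))
    (hμ : μ (GramClass.mk a) = -(Pi.single (cmPlaceOver (L : Type) (HypCensus.cmPlace (L : Type) ι₁)).1 1)) :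
    ∃ j : I V ρ μ, j.1 = q ∧
      line V ρ μ j =
        (SplitLineE.ofCMOf V e₁ (RealScalar.vec a) (RealScalar.vec_real a) (RealScalar.vec_ne a) hGR).twistBy
          (HodgeCM.LinePair.bigCharOfV (↥(maximalRealSubfield (L : Type))) (L : Type) (IsCMField.complexConj (L : Type)) 3
            (Matrix.diagonal (frameD V)) (Matrix.diagonal (RealScalar.vec a)) hJW cV) hĉ :=
  I.exists_line_eq_twistBy_ofCMOf_of_eq V μ hq hGR _ hĉ (continuous_twistInf_bigCharOfV V a hJW cV hcV)
    (hμ.trans (centralTypeOfTwist_bigCharOfV_of_CC V a hGR hJW cV hcV hCC _).symm)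

end LiuIndex

end HodgeCM.Model

end
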